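import Mathlib.NumberTheory.Padics.RingHoms
import Mathlib.LinearAlgebra.FreeModule.PID
import Mathlib.LinearAlgebra.Dimension.Constructions
import Mathlib.GroupTheory.Index
import Literature.NumberTheory.EllipticCurves.LocalPointsFiniteIndexLatticeProofs
import HarnessLib

set_option linter.dupNamespace false -- `…BirchSwinnertonDyer.BirchSwinnertonDyer…` is the cell's nested layout (D-0017)
set_option autoImplicit false

/-!
# Route `PrintX8VS`, crux 22569 `KatoFineLowerSporadicX8` (item (α) of `stub_cokerBoundOffT`): the BRIDGE
# «finite-index subgroup `H ≃+ ℤ_p^d` of an abelian group `A` ⟹ a SURJECTION `A ↠ ℤ_p^d`», and with it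
# `E(K_n·K_v) ↠ ℤ_p^{[K_n·K_v : ℚ_p]}` from the typed print fact Silverman AEC VII Prop. 6.3

LADDER-BSD D-0154 (2) INPUTS desk `pub/bsd-wall/bsd-inputs`, seat `bsd-inputs-honda-p1` g13 (director-bsd g15 2026-08-28T18:35Z: «if the
shape differs, honda-p1 types the bridge»); `--supports stmt-BirchSwinnertonDyer-22569 --as helper`. THEOREMS ONLY (no definition, no
named fact, no `sorry`); the pure algebra is Mathlib-only, the corollaries consume the Literature fact
`silvermanVII63_localLayerPoints_finiteIndex_zpLattice` (`Literature/NumberTheory/EllipticCurves/LocalPointsFiniteIndexLattice.lean`, p656226)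
through its reading lemma `….rat` (`…LatticeProofs.lean`, p656513).

## Why
The typed print fact has the shape «∃ `H ≤ E(K_n·K_v)` of finite index, `H ≃+ (Fin d → ℤ_[p])`, `d = [K_n·K_v : ℚ_p]`»
(Silverman's «`E(K)` contains a subgroup of finite index isomorphic to `R⁺`»); the consumer
`Literature/NumberTheory/EllipticCurves/Sprung2012/HondaOrbitRankOfSurjectiveProofs.lean` (cell `bsd-ssimc`, w2 g8, p657939:
`exists_linearMap_isColemanPair_cokernel_of_surjective_rat`) asks for «ONE surjection `E(ℚ_{p,2}) ↠ (Fin p² → ℤ_p)`». This file is the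
one-step bridge between the two shapes.

## The algebra (§1)
`A` abelian, `H ≤ A` of finite index `m`, `e : H ≃+ ℤ_p^d`. Put `φ(a) := e(m • a)` (`m • a ∈ H`, `AddSubgroup.nsmul_index_mem`):
additive, with `φ(e⁻¹x) = m • x`, so `range φ ⊇ m·ℤ_p^d`. The range is a `ℤ_p`-SUBMODULE: for `c ∈ ℤ_p` take `c₀ = appr(c) ∈ ℕ` with
`c − c₀ ∈ p^v ℤ_p = m ℤ_p` (`v = ord_p m`; `PadicInt.appr_spec`, `PadicInt.unitCoeff_spec`), `c − c₀ = t m`, and then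
`c • φ(a) = φ(c₀ • a) + m • (t • φ(a)) = φ(c₀ • a + e⁻¹(t • φ a))`. A submodule `M` with `m·ℤ_p^d ⊆ M ⊆ ℤ_p^d` is free over the
PID `ℤ_p` (`Submodule.basisOfPid`) of rank squeezed to `d` (`Submodule.finrank_mono`, `LinearMap.finrank_range_of_inj`), so
`M ≃ₗ ℤ_p^d` (`Basis.equivFun`) and `π := (M ≃ ℤ_p^d) ∘ φ` is onto: `exists_addMonoidHom_surjective_of_finiteIndex_of_equiv`;
relative form (`H ≤ L ≤ A`, `[L : H] < ∞`): `exists_addMonoidHom_surjective_of_le_of_finiteIndex_of_equiv`.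

## The local layers (§2)
`exists_addMonoidHom_surjective_localLayerPoints` (any number field, `d = [K_n·K_v : K_v]·e(v|p)f(v|p)`) and
`exists_addMonoidHom_surjective_localLayerPoints_rat` (`K = ℚ`: `d = (localLayerSubgroupOfEmb κ ι n).index`, `= pⁿ` for the cyclotomic
`κ` by `index_localLayerSubgroupOfEmb_eq_pow[_of_isTopGenerator]`) — at `n = 2` exactly the consumer's surjection, CONDITIONAL on the one
print binder `(h : silvermanVII63_localLayerPoints_finiteIndex_zpLattice)`.

Honest framing: §1 is unconditional folklore algebra; §2 is conditional on one cite-only textbook fact (Silverman VII.6.3). Nothing here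
proves item (α), crux 22569/22901/19875 or any summit statement; the Birch–Swinnerton-Dyer conjecture is NOT proved by any of this.
References: [SilvermanAEC2009] VII Prop. 6.3, IV Thm. 6.4 (b); [Sprung2012] Lemma 2.3; [NeukirchSchmidtWingberg2008] (5.3.*) (`ℤ_p`-lattices).
-/

noncomputable section

open Function

namespace Summit.BirchSwinnertonDyer.BirchSwinnertonDyer.Theorems.ZpLatticeSurjection

variable {p : ℕ} [Fact p.Prime]

/-- `‖n‖ = 1` in `ℤ_p` for a natural number `n` prime to `p`, i.e. `n` is a unit of `ℤ_p`. [folklore] -/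
private theorem isUnit_natCast_padicInt_of_not_dvd {n : ℕ} (hn : ¬ p ∣ n) : IsUnit (n : ℤ_[p]) := by
  rw [PadicInt.isUnit_iff]
  refine le_antisymm (PadicInt.norm_le_one _) (not_lt.mp fun hlt ↦ hn ?_)
  have h : ‖((n : ℤ) : ℤ_[p])‖ < 1 := by simpa using hlt
  exact_mod_cast (PadicInt.norm_int_lt_one_iff_dvd (n : ℤ)).mp h

/-- For a natural number `m ≠ 0`, the ideals `m ℤ_p` and `p^{ord_p m} ℤ_p` of `ℤ_p` coincide — in the form we use:
every `x ∈ p^v ℤ_p`, `v` the `p`-adic valuation of `m` in `ℤ_p`, is a multiple of `m`. [folklore] -/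
private theorem exists_mul_natCast_of_mem_span_pow {m : ℕ} (hm : m ≠ 0) {x : ℤ_[p]}
    (hx : x ∈ Ideal.span {(p : ℤ_[p]) ^ (m : ℤ_[p]).valuation}) : ∃ t : ℤ_[p], x = t * (m : ℤ_[p]) := by
  have hm0 : (m : ℤ_[p]) ≠ 0 := by exact_mod_cast hm
  obtain ⟨s, hs⟩ := Ideal.mem_span_singleton'.mp hx
  -- `m = u · p^v` with `u` a unit
  have hspec := PadicInt.unitCoeff_spec hm0
  have key : (((PadicInt.unitCoeff hm0)⁻¹ : ℤ_[p]ˣ) : ℤ_[p]) * (m : ℤ_[p]) =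
      (p : ℤ_[p]) ^ (m : ℤ_[p]).valuation := by
    rw [Units.inv_mul_eq_iff_eq_mul]
    exact hspec
  refine ⟨s * ((PadicInt.unitCoeff hm0)⁻¹ : ℤ_[p]ˣ), ?_⟩
  rw [mul_assoc, key]
  exact hs.symm

/-- **The bridge, absolute form.** An abelian group `A` with a finite-index subgroup `H ≃+ ℤ_p^d` surjects onto `ℤ_p^d`:
there is a surjective additive map `A →+ (Fin d → ℤ_[p])`. See the module docstring for the proof
(`φ = e ∘ (m • ·)`, its range is a finite-index `ℤ_p`-sublattice of `ℤ_p^d`, free of rank `d` over the PID `ℤ_p`). [folklore] -/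
theorem exists_addMonoidHom_surjective_of_finiteIndex_of_equiv {A : Type*} [AddCommGroup A] (H : AddSubgroup A)
    [H.FiniteIndex] {d : ℕ} (e : H ≃+ (Fin d → ℤ_[p])) :
    ∃ π : A →+ (Fin d → ℤ_[p]), Surjective π := by
  classical
  set m : ℕ := H.index with hm_def
  have hm : m ≠ 0 := AddSubgroup.FiniteIndex.index_ne_zero
  have hm0 : (m : ℤ_[p]) ≠ 0 := by exact_mod_cast hm
  -- `φ(a) = e(m • a)`
  let ψ : A →+ H :=
    { toFun := fun a ↦ ⟨m • a, AddSubgroup.nsmul_index_mem H a⟩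
      map_zero' := by ext; simp
      map_add' := fun a b ↦ by ext; simp [smul_add] }
  let φ : A →+ (Fin d → ℤ_[p]) := e.toAddMonoidHom.comp ψ
  have hφ : ∀ a : A, φ a = e ⟨m • a, AddSubgroup.nsmul_index_mem H a⟩ := fun a ↦ rfl
  -- `φ(e⁻¹ x) = m • x`
  have hφsymm : ∀ x : Fin d → ℤ_[p], φ ((e.symm x : H) : A) = (m : ℤ_[p]) • x := by
    intro x
    rw [hφ]
    have h1 : (⟨m • ((e.symm x : H) : A), AddSubgroup.nsmul_index_mem H _⟩ : H) = m • e.symm x := by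
      ext; simp
    rw [h1, map_nsmul, AddEquiv.apply_symm_apply, Nat.cast_smul_eq_nsmul]
  -- the range of `φ` is a `ℤ_p`-submodule
  have hsmul : ∀ (c : ℤ_[p]) {y : Fin d → ℤ_[p]}, y ∈ Set.range φ → c • y ∈ Set.range φ := by
    intro c y hy
    obtain ⟨a, rfl⟩ := hy
    set v : ℕ := (m : ℤ_[p]).valuation
    obtain ⟨t, ht⟩ := exists_mul_natCast_of_mem_span_pow (p := p) hm (PadicInt.appr_spec v c)
    have hc : c = ((c.appr v : ℕ) : ℤ_[p]) + t * (m : ℤ_[p]) := by rw [← ht]; ring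
    refine ⟨(c.appr v) • a + ((e.symm (t • φ a) : H) : A), ?_⟩
    rw [map_add, map_nsmul, hφsymm]
    conv_rhs => rw [hc, add_smul, Nat.cast_smul_eq_nsmul, mul_comm, mul_smul]
  let M : Submodule ℤ_[p] (Fin d → ℤ_[p]) :=
    { carrier := Set.range φ
      add_mem' := fun {x y} hx hy ↦ by
        obtain ⟨a, rfl⟩ := hx; obtain ⟨b, rfl⟩ := hy; exact ⟨a + b, map_add φ a b⟩
      zero_mem' := ⟨0, map_zero φ⟩
      smul_mem' := fun c {y} hy ↦ hsmul c hy }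
  have hMmem : ∀ y, y ∈ M ↔ y ∈ Set.range φ := fun _ ↦ Iff.rfl
  -- `m • ℤ_p^d ⊆ M`, so `finrank M = d`
  let μ : (Fin d → ℤ_[p]) →ₗ[ℤ_[p]] (Fin d → ℤ_[p]) := (m : ℤ_[p]) • LinearMap.id
  have hμinj : Injective μ := fun x y hxy ↦ smul_right_injective (Fin d → ℤ_[p]) hm0 (by simpa [μ] using hxy)
  have hμle : LinearMap.range μ ≤ M := by
    rintro y ⟨x, rfl⟩
    exact (hMmem _).mpr ⟨_, hφsymm x⟩
  have hrank : Module.finrank ℤ_[p] M = d := by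
    refine le_antisymm ?_ ?_
    · simpa using Submodule.finrank_mono (le_top : M ≤ ⊤)
    · have h := Submodule.finrank_mono hμle
      rwa [LinearMap.finrank_range_of_inj hμinj, Module.finrank_fin_fun] at h
  -- `M` is free of rank `d`
  obtain ⟨n, bM⟩ := Submodule.basisOfPid (Pi.basisFun ℤ_[p] (Fin d)) M
  have hn : n = d := by
    have h := Module.finrank_eq_card_basis bM
    rw [hrank, Fintype.card_fin] at h
    exact h.symm
  let bM' : Module.Basis (Fin d) ℤ_[p] M := bM.reindex (finCongr hn)
  let ε : M ≃ₗ[ℤ_[p]] (Fin d → ℤ_[p]) := bM'.equivFun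
  -- `π = ε ∘ φ`
  let φM : A →+ M :=
    { toFun := fun a ↦ ⟨φ a, (hMmem _).mpr ⟨a, rfl⟩⟩
      map_zero' := by ext; simp
      map_add' := fun a b ↦ by ext; simp }
  refine ⟨ε.toAddEquiv.toAddMonoidHom.comp φM, fun y ↦ ?_⟩
  obtain ⟨a, ha⟩ := (hMmem _).mp (ε.symm y).2
  refine ⟨a, ?_⟩
  have hφM : φM a = ε.symm y := Subtype.ext ha
  simp [hφM]

/-- **The bridge, relative form** (the shape of `silvermanVII63_localLayerPoints_finiteIndex_zpLattice`): for subgroups `H ≤ L`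
of an abelian group `A` with `[L : H] < ∞` and `H ≃+ ℤ_p^d` there is a surjective additive map `L →+ (Fin d → ℤ_[p])`. [folklore] -/
theorem exists_addMonoidHom_surjective_of_le_of_finiteIndex_of_equiv {A : Type*} [AddCommGroup A] {H L : AddSubgroup A}
    (hHL : H ≤ L) (hfi : (H.addSubgroupOf L).FiniteIndex) {d : ℕ} (e : H ≃+ (Fin d → ℤ_[p])) :
    ∃ π : L →+ (Fin d → ℤ_[p]), Surjective π :=
  haveI := hfi
  exists_addMonoidHom_surjective_of_finiteIndex_of_equiv (H.addSubgroupOf L)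
    ((AddSubgroup.addSubgroupOfEquivOfLe hHL).trans e)


/-! ## The local layers: `E(K_n·K_v) ↠ ℤ_p^{[K_n·K_v : ℚ_p]}` from the typed print fact (Silverman AEC VII Prop. 6.3) -/

section LocalLayers

open NumberField IsDedekindDomain Literature.NumberTheory.EllipticCurves

/-- **`E(K_n·K_v)` surjects onto `ℤ_p^{[K_n·K_v : ℚ_p]}`** — the typed print fact
`silvermanVII63_localLayerPoints_finiteIndex_zpLattice` (Silverman AEC VII Prop. 6.3 + IV Thm. 6.4 (b): a finite-index subgroup
`≅ 𝓞_L⁺ ≅ ℤ_p^{[L:ℚ_p]}` of `E(L)`, `L = K_n·K_v`) pushed through the bridge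
`exists_addMonoidHom_surjective_of_le_of_finiteIndex_of_equiv`: for a number field `K`, `v ∣ p`, any `ℤ_p`-extension `κ`, any `ι`,
an elliptic `W/K` and every `n` there is a surjective additive map
`localLayerPointsOfEmb κ ι W n →+ (Fin ([K_n·K_v : K_v]·e(v|p)f(v|p)) → ℤ_[p])`. CONDITIONAL on the named fact (`h`).
[cite: SilvermanAEC2009, VII Prop. 6.3 and IV Thm. 6.4 (b)] -/
theorem exists_addMonoidHom_surjective_localLayerPoints (h : silvermanVII63_localLayerPoints_finiteIndex_zpLattice)
    {K : Type} [Field K] [NumberField K] {p : ℕ} [Fact p.Prime] (κ : ZpExtension K p) {v : HeightOneSpectrum (𝓞 K)}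
    (hv : ((p : ℕ) : 𝓞 K) ∈ v.asIdeal) (ι : AlgebraicClosure K →ₐ[K] AlgebraicClosure (v.adicCompletion K))
    (W : WeierstrassCurve K) [W.IsElliptic] (n : ℕ) :
    ∃ π : Kobayashi2003.localLayerPointsOfEmb κ ι W n →+
        (Fin ((Kobayashi2003.localLayerSubgroupOfEmb κ ι n).index * (v.asIdeal.ramificationIdx ℤ * v.asIdeal.inertiaDeg ℤ)) → ℤ_[p]),
      Surjective π := by
  obtain ⟨H, hHL, hfi, ⟨e⟩⟩ := h K p κ v hv ι W n
  exact exists_addMonoidHom_surjective_of_le_of_finiteIndex_of_equiv hHL hfi e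

/-- **The `K = ℚ` shape consumed by `Sprung2012/HondaOrbitRankOfSurjectiveProofs.lean`** («ONE surjection
`E(ℚ_{n,v}) ↠ (Fin [ℚ_{n,v} : ℚ_p] → ℤ_p)»): for `W/ℚ` elliptic, `v ∋ p`, any `ℤ_p`-extension `κ` of `ℚ`, any `ι` and every `n`,
a surjective additive map `localLayerPointsOfEmb κ ι W n →+ (Fin (localLayerSubgroupOfEmb κ ι n).index → ℤ_[p])` (`e(p|p)f(p|p) = 1`
inside `silvermanVII63_….rat`; for the cyclotomic `κ` the index is `pⁿ`, `index_localLayerSubgroupOfEmb_eq_pow` /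
`…_of_isTopGenerator`). CONDITIONAL on the named fact (`h`); BSD is not proved by this.
[cite: SilvermanAEC2009, VII Prop. 6.3 and IV Thm. 6.4 (b)] [cite: Sprung2012, Lemma 2.3 (p. 1488)] -/
theorem exists_addMonoidHom_surjective_localLayerPoints_rat (h : silvermanVII63_localLayerPoints_finiteIndex_zpLattice)
    {p : ℕ} [Fact p.Prime] (κ : ZpExtension ℚ p) {v : HeightOneSpectrum (𝓞 ℚ)} (hv : ((p : ℕ) : 𝓞 ℚ) ∈ v.asIdeal)
    (ι : AlgebraicClosure ℚ →ₐ[ℚ] AlgebraicClosure (v.adicCompletion ℚ)) (W : WeierstrassCurve ℚ) [W.IsElliptic] (n : ℕ) :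
    ∃ π : Kobayashi2003.localLayerPointsOfEmb κ ι W n →+
        (Fin (Kobayashi2003.localLayerSubgroupOfEmb κ ι n).index → ℤ_[p]), Surjective π := by
  obtain ⟨H, hHL, hfi, ⟨e⟩⟩ := silvermanVII63_localLayerPoints_finiteIndex_zpLattice.rat h κ hv ι W n
  exact exists_addMonoidHom_surjective_of_le_of_finiteIndex_of_equiv hHL hfi e

end LocalLayers

end Summit.BirchSwinnertonDyer.BirchSwinnertonDyer.Theorems.ZpLatticeSurjection

end
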